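import Summits.NavierStokesRegularity.NavierStokesRegularity.Theorems.QuietScarPocketDoorZoomTop
import HarnessLib

/-!
# QuietScarPocketDoorLZoomTopData — door S31 «QuietScarPocketDoor», §B «L-POCKET SCHEMA» (texts nsreg-p1 g25
# `r29/Sketch31D.lean` 8bb56c0a84466268, tree `…QuietScarPocketDoorLPocketDefs`), plate (P1) PK1-L, file F4_L part 1:
# the zooms' data on off-apex top cylinders, the scale-invariant gradient bound, and the limit package (values AND gradients)

* `eventually_zoom_cylinder_data` — brick R's data exposed: on `Q((0,y₀), ‖y₀‖/4)`, eventually in `k`, the zoom is classical with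
  `‖w k‖ ≤ (C_u/3)/c`, its ball-mean-gauged pressure is a locally integrable gauge of plain mass `≤ c²·I`;
* `exists_zoom_fderiv_bound` — ONE `K` (Pineau–Vicol's quantitative Serrin bound `exists_forall_fderiv_le_of_bounded (C_u/3) I`):
  `‖D_x w k‖ ≤ K/(‖y₀‖/4)²` on `Q((0,y₀), ‖y₀‖/8)` for all large `k`, every `y₀ ≠ 0` (SCALE-INVARIANT);
* `exists_limit_package₂` — `exists_limit_package` of `…ZoomTop` with the VALUE clauses exported: pointwise convergence of
  values and gradients along a subsequence and BOTH joint Hölder moduli inherited by `U` up to the top.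

Width-seat file (prover ns-imp-p1 g4, first plate hand of the S-door lane, DIRECTOR-NS #209 (2) / #210 (3); planner of record
nsreg-p1 g25), `--supports stmt-NavierStokesRegularity-0056 --as helper`.  WHAT THIS IS NOT: a corollary schema of the S31
CRITERION about HYPOTHETICAL one-point Type-I blow-up; 0056 `NoTypeII` / NS regularity NOT proved.
-/

noncomputable section

set_option linter.dupNamespace false

namespace Summit.NavierStokesRegularity.NavierStokesRegularity.Theorems.QuietScarPocketDoor

open MeasureTheory Set Function Filter Topology TopologicalSpace Metric
open scoped NNReal ENNReal Topology
open Literature.Analysis Literature.Analysis.FluidPDE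
open Summit.NavierStokesRegularity.NavierStokesRegularity.Theorems.LocalIrrotationalScarDoorZoomTraceTools
  (tendsto_fderiv_of_tendsto_of_taylor)
open Summit.NavierStokesRegularity.NavierStokesRegularity.Theorems.LocalIrrotationalScarDoorZoomTopFading
  (taylor_bound_of_iteratedFDeriv_two)
open Summit.NavierStokesRegularity.NavierStokesRegularity.Theorems.LocalIrrotationalScarDoorZoomDataTop
  (mem_parabolicCylinder_top_iff)

/-! ## The zooms' data on the off-apex top cylinders `Q((0,y₀), ‖y₀‖/4)` -/

/-- **The data of the zooms on `Q((0,y₀), ‖y₀‖/4)`, eventually in `k`** (brick R, exposed): the cylinder lies in the zoom's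
domain, the zoom is classical there with `‖w k‖ ≤ (C_u/3)/c`, `c = ‖y₀‖/4`, the ball mean of its pressure is a locally integrable
gauge, and the gauged pressure has plain mass `≤ c²·I`. -/
theorem eventually_zoom_cylinder_data {Cu : ℝ}
    {w : ℕ → ℝ → EuclideanSpace ℝ (Fin 3) → EuclideanSpace ℝ (Fin 3)} {π : ℕ → ℝ → EuclideanSpace ℝ (Fin 3) → ℝ}
    {Rk : ℕ → ℝ} {I : ℝ≥0} (hCu : 0 ≤ Cu) (hRk : Tendsto Rk atTop atTop)
    (hcl : ∀ k, IsClassicalNSSolutionOnRegion (parabolicCylinder (Rk k) (0 : ℝ × EuclideanSpace ℝ (Fin 3))) 1 0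
      (w k) (π k))
    (hone : ∀ k, ∀ z ∈ parabolicCylinder (Rk k) (0 : ℝ × EuclideanSpace ℝ (Fin 3)),
      ‖w k z.1 z.2‖ ≤ Cu / (Real.sqrt (-z.1) + ‖z.2‖))
    (hIk : ∀ k, typeIBound (parabolicCylinder (Rk k) (0 : ℝ × EuclideanSpace ℝ (Fin 3))) (w k) (π k)
      (fun t x => fderiv ℝ (w k t) x) ≤ I)
    {y₀ : EuclideanSpace ℝ (Fin 3)} (hy₀ : y₀ ≠ 0) :
    ∀ᶠ k in atTop,
      parabolicCylinder (‖y₀‖ / 4) (((0 : ℝ), y₀) : ℝ × EuclideanSpace ℝ (Fin 3)) ⊆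
        parabolicCylinder (Rk k) (0 : ℝ × EuclideanSpace ℝ (Fin 3)) ∧
      IsClassicalNSSolutionOnRegion (parabolicCylinder (‖y₀‖ / 4) (((0 : ℝ), y₀) : ℝ × EuclideanSpace ℝ (Fin 3))) 1 0
        (w k) (π k) ∧
      (∀ z ∈ parabolicCylinder (‖y₀‖ / 4) (((0 : ℝ), y₀) : ℝ × EuclideanSpace ℝ (Fin 3)),
        ‖w k z.1 z.2‖ ≤ (Cu / 3) / (‖y₀‖ / 4)) ∧
      LocallyIntegrableOn (fun z : ℝ × EuclideanSpace ℝ (Fin 3) => ⨍ y in ball y₀ (‖y₀‖ / 4), π k z.1 y)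
        (parabolicCylinder (‖y₀‖ / 4) (((0 : ℝ), y₀) : ℝ × EuclideanSpace ℝ (Fin 3))) volume ∧
      (∫⁻ z in parabolicCylinder (‖y₀‖ / 4) (((0 : ℝ), y₀) : ℝ × EuclideanSpace ℝ (Fin 3)),
          ‖π k z.1 z.2 - ⨍ y in ball y₀ (‖y₀‖ / 4), π k z.1 y‖ₑ ^ (3 / 2 : ℝ) ≤
        ENNReal.ofReal ((‖y₀‖ / 4) ^ 2) * I) := by
  have hy : 0 < ‖y₀‖ := norm_pos_iff.2 hy₀
  set c : ℝ := ‖y₀‖ / 4 with hc_def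
  have hc : 0 < c := by positivity
  filter_upwards [tendsto_atTop.1 hRk (‖y₀‖ + c + 1)] with k hk
  have hRk' : ‖y₀‖ + c ≤ Rk k := by linarith
  have hsubk : parabolicCylinder c (((0 : ℝ), y₀) : ℝ × EuclideanSpace ℝ (Fin 3)) ⊆
      parabolicCylinder (Rk k) (0 : ℝ × EuclideanSpace ℝ (Fin 3)) :=
    parabolicCylinder_top_subset hc hRk'
  refine ⟨hsubk, (hcl k).mono_of_isOpen hsubk (isOpen_parabolicCylinder _ _), fun z hz => ?_, ?_, ?_⟩
  · have h1 := hone k z (hsubk hz)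
    rw [mem_parabolicCylinder] at hz
    have hz2 : 3 * c ≤ ‖z.2‖ := by
      have h3 : dist z.2 y₀ < c := by simpa using hz.2
      have : ‖y₀‖ ≤ ‖z.2‖ + dist z.2 y₀ := by
        rw [dist_eq_norm, norm_sub_rev]; exact norm_le_norm_add_norm_sub' y₀ z.2 |>.trans_eq (by ring)
      rw [hc_def]; linarith
    have hden : 3 * c ≤ Real.sqrt (-z.1) + ‖z.2‖ := by linarith [Real.sqrt_nonneg (-z.1)]
    calc ‖w k z.1 z.2‖ ≤ Cu / (Real.sqrt (-z.1) + ‖z.2‖) := h1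
      _ ≤ Cu / (3 * c) := div_le_div_of_nonneg_left hCu (by positivity) hden
      _ = (Cu / 3) / c := by rw [div_div]
  · refine locallyIntegrableOn_ballMean (isOpen_parabolicCylinder _ _) (hcl k).smooth_pressure.continuousOn
      fun z hz => ?_
    obtain ⟨hz1, hz2⟩ := hz
    rw [mem_parabolicCylinder]
    have hcR : c ≤ Rk k := by linarith [norm_nonneg y₀]
    refine ⟨⟨?_, by simpa using hz1.2⟩, ?_⟩
    · simp only [Prod.fst_zero]
      nlinarith [hz1.1]
    · simp only [Prod.snd_zero, dist_zero_right]
      have h3 : ‖z.2 - y₀‖ ≤ c := by simpa [dist_eq_norm] using (mem_closedBall.1 hz2)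
      have : ‖z.2‖ ≤ ‖z.2 - y₀‖ + ‖y₀‖ := norm_le_norm_sub_add z.2 y₀
      linarith
  · have hD := cknD_sub_ballMean_le_of_typeIBound_le (hIk k) hc hsubk
    rw [cknD] at hD
    have h0 : ENNReal.ofReal c ^ 2 ≠ 0 := pow_ne_zero _ (ENNReal.ofReal_pos.2 hc).ne'
    have htop : ENNReal.ofReal c ^ 2 ≠ ⊤ := ENNReal.pow_ne_top ENNReal.ofReal_ne_top
    calc ∫⁻ z in parabolicCylinder c (((0 : ℝ), y₀) : ℝ × EuclideanSpace ℝ (Fin 3)),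
          ‖π k z.1 z.2 - ⨍ y in ball y₀ c, π k z.1 y‖ₑ ^ (3 / 2 : ℝ)
        = ENNReal.ofReal c ^ 2 * ((ENNReal.ofReal c ^ 2)⁻¹ *
            ∫⁻ z in parabolicCylinder c (((0 : ℝ), y₀) : ℝ × EuclideanSpace ℝ (Fin 3)),
              ‖π k z.1 z.2 - ⨍ y in ball y₀ c, π k z.1 y‖ₑ ^ (3 / 2 : ℝ)) := by
          rw [← mul_assoc, ENNReal.mul_inv_cancel h0 htop, one_mul]
      _ ≤ ENNReal.ofReal c ^ 2 * I := by gcongr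
      _ = ENNReal.ofReal (c ^ 2) * I := by rw [ENNReal.ofReal_pow hc.le]

/-- **Scale-invariant gradient bound of the zooms off the apex, up to the top** (Pineau–Vicol's quantitative Serrin bound
`exists_forall_fderiv_le_of_bounded (C_u/3) I` on the cylinders of `eventually_zoom_cylinder_data`): ONE `K` such that at every
`y₀ ≠ 0`, for all large `k`, `‖D_x w k‖ ≤ K/(‖y₀‖/4)²` on `Q((0,y₀), ‖y₀‖/8)`. -/
theorem exists_zoom_fderiv_bound {Cu : ℝ}
    {w : ℕ → ℝ → EuclideanSpace ℝ (Fin 3) → EuclideanSpace ℝ (Fin 3)} {π : ℕ → ℝ → EuclideanSpace ℝ (Fin 3) → ℝ}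
    {Rk : ℕ → ℝ} {I : ℝ≥0} (hCu : 0 ≤ Cu) (hRk : Tendsto Rk atTop atTop)
    (hcl : ∀ k, IsClassicalNSSolutionOnRegion (parabolicCylinder (Rk k) (0 : ℝ × EuclideanSpace ℝ (Fin 3))) 1 0
      (w k) (π k))
    (hone : ∀ k, ∀ z ∈ parabolicCylinder (Rk k) (0 : ℝ × EuclideanSpace ℝ (Fin 3)),
      ‖w k z.1 z.2‖ ≤ Cu / (Real.sqrt (-z.1) + ‖z.2‖))
    (hIk : ∀ k, typeIBound (parabolicCylinder (Rk k) (0 : ℝ × EuclideanSpace ℝ (Fin 3))) (w k) (π k)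
      (fun t x => fderiv ℝ (w k t) x) ≤ I) :
    ∃ K : ℝ, 0 ≤ K ∧ ∀ y₀ : EuclideanSpace ℝ (Fin 3), y₀ ≠ 0 → ∀ᶠ k in atTop,
      ∀ z ∈ parabolicCylinder (‖y₀‖ / 8) (((0 : ℝ), y₀) : ℝ × EuclideanSpace ℝ (Fin 3)),
        ‖fderiv ℝ (w k z.1) z.2‖ ≤ K / (‖y₀‖ / 4) ^ 2 := by
  obtain ⟨K, hK, hfact⟩ := exists_forall_fderiv_le_of_bounded (Cu / 3) I
  refine ⟨K, hK, fun y₀ hy₀ => ?_⟩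
  have hc : 0 < ‖y₀‖ / 4 := by have := norm_pos_iff.2 hy₀; positivity
  have e8 : ‖y₀‖ / 4 / 2 = ‖y₀‖ / 8 := by ring
  filter_upwards [eventually_zoom_cylinder_data hCu hRk hcl hone hIk hy₀] with k hk
  obtain ⟨-, hclk, hbd, hloc, hP⟩ := hk
  have h := hfact (w k) (π k) (fun t => ⨍ y in ball y₀ (‖y₀‖ / 4), π k t y) ((0 : ℝ), y₀) (‖y₀‖ / 4) hc hclk
    hbd hloc hP
  rw [e8] at h
  exact h

/-! ## The limit package with values AND gradients -/

set_option maxHeartbeats 400000 in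
/-- **The limit package at `y₀ ≠ 0`, values and gradients** (`exists_limit_package` of `…ZoomTop` with the value clauses
exported): `C ≥ 0`, exponents `α₀, α₁ > 0`, a subsequence `φ`, with (i) the `k`-uniform joint Hölder modulus of `D_x(w k)` on
`Q((0,y₀), ‖y₀‖/8)`; (ii) `w (φ j) → U` pointwise there and (iii) the values of `U` jointly `(C,α₀)`-Hölder there; (iv)
`D_x(w (φ j)) → D_x U` pointwise on `Q((0,y₀), ‖y₀‖/16)` and (v) `D_x U` jointly `(C,α₁)`-Hölder there — all up to the top. -/
theorem exists_limit_package₂ {Cu : ℝ}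
    {w : ℕ → ℝ → EuclideanSpace ℝ (Fin 3) → EuclideanSpace ℝ (Fin 3)} {π : ℕ → ℝ → EuclideanSpace ℝ (Fin 3) → ℝ}
    {Rk : ℕ → ℝ} {I : ℝ≥0} {U : ℝ → EuclideanSpace ℝ (Fin 3) → EuclideanSpace ℝ (Fin 3)}
    (hCu : 0 ≤ Cu) (hRk : Tendsto Rk atTop atTop)
    (hcl : ∀ k, IsClassicalNSSolutionOnRegion (parabolicCylinder (Rk k) (0 : ℝ × EuclideanSpace ℝ (Fin 3))) 1 0
      (w k) (π k))
    (hone : ∀ k, ∀ z ∈ parabolicCylinder (Rk k) (0 : ℝ × EuclideanSpace ℝ (Fin 3)),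
      ‖w k z.1 z.2‖ ≤ Cu / (Real.sqrt (-z.1) + ‖z.2‖))
    (hIk : ∀ k, typeIBound (parabolicCylinder (Rk k) (0 : ℝ × EuclideanSpace ℝ (Fin 3))) (w k) (π k)
      (fun t x => fderiv ℝ (w k t) x) ≤ I)
    (hUc : ContinuousOn (uncurry U) (Iio (0 : ℝ) ×ˢ univ))
    (hUd : ∀ s : ℝ, s < 0 → ∀ x : EuclideanSpace ℝ (Fin 3), DifferentiableAt ℝ (U s) x)
    (hL3 : ∀ r : ℝ, 0 < r → Tendsto (fun k => eLpNorm (uncurry (w k) - uncurry U) 3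
      (volume.restrict (parabolicCylinder r (0 : ℝ × EuclideanSpace ℝ (Fin 3))))) atTop (𝓝 0))
    {y₀ : EuclideanSpace ℝ (Fin 3)} (hy₀ : y₀ ≠ 0) :
    ∃ C α₀ α₁ : ℝ, 0 < α₀ ∧ 0 < α₁ ∧ 0 ≤ C ∧ ∃ φ : ℕ → ℕ, StrictMono φ ∧
      (∀ᶠ k in atTop, ∀ z ∈ parabolicCylinder (‖y₀‖ / 8) (((0 : ℝ), y₀) : ℝ × EuclideanSpace ℝ (Fin 3)),
        ∀ z' ∈ parabolicCylinder (‖y₀‖ / 8) (((0 : ℝ), y₀) : ℝ × EuclideanSpace ℝ (Fin 3)),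
          dist (fderiv ℝ (w k z.1) z.2) (fderiv ℝ (w k z'.1) z'.2) ≤ C * dist z z' ^ α₁) ∧
      (∀ z ∈ parabolicCylinder (‖y₀‖ / 8) (((0 : ℝ), y₀) : ℝ × EuclideanSpace ℝ (Fin 3)),
        Tendsto (fun j => w (φ j) z.1 z.2) atTop (𝓝 (U z.1 z.2))) ∧
      (∀ z ∈ parabolicCylinder (‖y₀‖ / 8) (((0 : ℝ), y₀) : ℝ × EuclideanSpace ℝ (Fin 3)),
        ∀ z' ∈ parabolicCylinder (‖y₀‖ / 8) (((0 : ℝ), y₀) : ℝ × EuclideanSpace ℝ (Fin 3)),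
          dist (U z.1 z.2) (U z'.1 z'.2) ≤ C * dist z z' ^ α₀) ∧
      (∀ z ∈ parabolicCylinder (‖y₀‖ / 16) (((0 : ℝ), y₀) : ℝ × EuclideanSpace ℝ (Fin 3)),
        Tendsto (fun j => fderiv ℝ (w (φ j) z.1) z.2) atTop (𝓝 (fderiv ℝ (U z.1) z.2))) ∧
      (∀ z ∈ parabolicCylinder (‖y₀‖ / 16) (((0 : ℝ), y₀) : ℝ × EuclideanSpace ℝ (Fin 3)),
        ∀ z' ∈ parabolicCylinder (‖y₀‖ / 16) (((0 : ℝ), y₀) : ℝ × EuclideanSpace ℝ (Fin 3)),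
          dist (fderiv ℝ (U z.1) z.2) (fderiv ℝ (U z'.1) z'.2) ≤ C * dist z z' ^ α₁) := by
  have hy : 0 < ‖y₀‖ := norm_pos_iff.2 hy₀
  obtain ⟨K, C, α₀, α₁, hα₀, hα₁, hC, hev⟩ := exists_zoom_regularity hCu hRk hcl hone hIk hy₀
  set Q₈ : Set (ℝ × EuclideanSpace ℝ (Fin 3)) :=
    parabolicCylinder (‖y₀‖ / 8) (((0 : ℝ), y₀) : ℝ × EuclideanSpace ℝ (Fin 3)) with hQ₈
  have h16 := topCylinder_sixteenth_subset_eighth y₀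
  set r : ℝ := ‖y₀‖ + ‖y₀‖ / 8 + 1 with hr_def
  have hr : 0 < r := by positivity
  have h8r : Q₈ ⊆ parabolicCylinder r (0 : ℝ × EuclideanSpace ℝ (Fin 3)) :=
    parabolicCylinder_top_subset (by positivity) (by rw [hr_def]; linarith)
  have hevR : ∀ᶠ k in atTop, parabolicCylinder r (0 : ℝ × EuclideanSpace ℝ (Fin 3)) ⊆
      parabolicCylinder (Rk k) (0 : ℝ × EuclideanSpace ℝ (Fin 3)) := by
    filter_upwards [tendsto_atTop.1 hRk r] with k hk
    exact parabolicCylinder_mono hr.le hk _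
  have hslab : parabolicCylinder r (0 : ℝ × EuclideanSpace ℝ (Fin 3)) ⊆ Iio (0 : ℝ) ×ˢ univ := by
    intro z hz
    rw [mem_parabolicCylinder] at hz
    exact ⟨by simpa using hz.1.2, mem_univ _⟩
  have hwm : ∀ᶠ k in atTop, AEStronglyMeasurable (uncurry (w k))
      (volume.restrict (parabolicCylinder r (0 : ℝ × EuclideanSpace ℝ (Fin 3)))) := by
    filter_upwards [hevR] with k hk
    exact ((hcl k).smooth_velocity.continuousOn.mono hk).aestronglyMeasurable
      (isOpen_parabolicCylinder _ _).measurableSet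
  have hUm : AEStronglyMeasurable (uncurry U)
      (volume.restrict (parabolicCylinder r (0 : ℝ × EuclideanSpace ℝ (Fin 3)))) :=
    (hUc.mono hslab).aestronglyMeasurable (isOpen_parabolicCylinder _ _).measurableSet
  obtain ⟨φ, hφ, hae⟩ := exists_subseq_ae_tendsto_of_eLpNorm_three hwm hUm (hL3 r hr)
  have hφt : Tendsto φ atTop atTop := hφ.tendsto_atTop
  have hev' := hφt.eventually hev
  have hevR' := hφt.eventually hevR
  have hae8 : ∀ᵐ z ∂(volume.restrict Q₈), Tendsto (fun j => uncurry (w (φ j)) z) atTop (𝓝 (uncurry U z)) :=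
    ae_restrict_of_ae_restrict_of_subset h8r hae
  have hU8 : ContinuousOn (uncurry U) Q₈ := hUc.mono (h8r.trans hslab)
  have hH0 : ∀ᶠ j in atTop, ∀ z ∈ Q₈, ∀ z' ∈ Q₈,
      dist (uncurry (w (φ j)) z) (uncurry (w (φ j)) z') ≤ C * dist z z' ^ α₀ := by
    filter_upwards [hev'] with j hj
    exact fun z hz z' hz' => hj.2.1 z hz z' hz'
  have hval : ∀ z ∈ Q₈, Tendsto (fun j => uncurry (w (φ j)) z) atTop (𝓝 (uncurry U z)) :=
    tendsto_of_ae_tendsto_of_equiHolder (isOpen_parabolicCylinder _ _) hae8 hU8 hα₀ hH0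
  have hgrad : ∀ z ∈ parabolicCylinder (‖y₀‖ / 16) (((0 : ℝ), y₀) : ℝ × EuclideanSpace ℝ (Fin 3)),
      Tendsto (fun j => fderiv ℝ (w (φ j) z.1) z.2) atTop (𝓝 (fderiv ℝ (U z.1) z.2)) := by
    rintro ⟨s, x⟩ hz
    have hρ : 0 < ‖y₀‖ / 16 := by positivity
    have hlim : ∀ y ∈ ball x (‖y₀‖ / 16), Tendsto (fun j => w (φ j) s y) atTop (𝓝 (U s y)) :=
      fun y hy => hval (s, y) (mem_topCylinder_eighth_of_ball hz hy)
    have htaylor : ∀ᶠ j in atTop, ∀ h : EuclideanSpace ℝ (Fin 3), ‖h‖ < ‖y₀‖ / 16 →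
        ‖w (φ j) s (x + h) - w (φ j) s x - fderiv ℝ (w (φ j) s) x h‖ ≤ K * ‖h‖ ^ 2 := by
      filter_upwards [hev', hevR'] with j hj hjR
      intro h hh
      refine taylor_bound_of_iteratedFDeriv_two (fun y hy => ?_) (fun y hy => ?_) hh
      · have hmem : ((s, y) : ℝ × EuclideanSpace ℝ (Fin 3)) ∈
            parabolicCylinder (Rk (φ j)) (0 : ℝ × EuclideanSpace ℝ (Fin 3)) :=
          hjR (h8r (mem_topCylinder_eighth_of_ball hz hy))
        have h1 := (hcl (φ j)).contDiffAt_velocity (isOpen_parabolicCylinder _ _) hmem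
        have h2 : ContDiffAt ℝ (⊤ : ℕ∞) (w (φ j) s) y :=
          h1.comp y (contDiffAt_const.prodMk contDiffAt_id)
        exact h2.of_le (by norm_cast)
      · exact hj.1 (s, y) (mem_topCylinder_eighth_of_ball hz hy) 2 le_rfl
    exact tendsto_fderiv_of_tendsto_of_taylor hρ hlim htaylor (hUd s (neg_of_mem_topCylinder hz) x)
  refine ⟨C, α₀, α₁, hα₀, hα₁, hC, φ, hφ, ?_, fun z hz => hval z hz, fun z hz z' hz' => ?_, hgrad,
    fun z hz z' hz' => ?_⟩
  · filter_upwards [hev] with k hk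
    exact hk.2.2
  · refine le_of_tendsto ((hval z hz).dist (hval z' hz')) ?_
    filter_upwards [hev'] with j hj
    exact hj.2.1 z hz z' hz'
  · refine le_of_tendsto ((hgrad z hz).dist (hgrad z' hz')) ?_
    filter_upwards [hev'] with j hj
    exact hj.2.2 z (h16 hz) z' (h16 hz')

end Summit.NavierStokesRegularity.NavierStokesRegularity.Theorems.QuietScarPocketDoor

end
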